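import Literature.AlgebraicGeometry.Resolution.GraphClosureFibreDimension
import Literature.AlgebraicGeometry.Resolution.BirationalLocalIso
import Literature.AlgebraicGeometry.Resolution.SmoothOverNormal
import Literature.AlgebraicGeometry.Resolution.AlterationsStrictTransformModel
import Literature.AlgebraicGeometry.Resolution.AlterationsGraphClosureProofs
import HarnessLib

/-!
# De Jong 1996, Lemma 4.20 and 4.21: `pr₁ : T → 𝒞` has finite fibres — PROOF of the named fact
# `DeJong1996GraphClosureFiniteFibres`

Topic: `Literature/AlgebraicGeometry/Resolution`. This file discharges the named fact
`DeJong1996GraphClosureFiniteFibres` of `AlterationsGraphClosure.lean` (its companion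
`AlterationsGraphClosureProofs.lean` discharges the other fact used there,
`DeJong1996SemiStableCurveNormal`; together they make 4.21, `isIso_graphClosureFst` and
`exists_extension`, unconditional — see the end of this file):

> "4.20. Lemma. — In the situation above. (i) For each `i`, `1 ≤ i ≤ r` there is exactly one
> `j = jᵢ` such that `pr₂(Tᵢ) = X_j`. There is an open subscheme `V = Vᵢ ⊂ X` such that `V ∩ Xᵢ`
> is nonempty, and `pr₂⁻¹(V) → V` is an isomorphism. The morphism `pr₁ : Tᵢ → 𝒞_s` is
> nonconstant. (ii) [the same for `pr₁`] […] 4.21. In the situation of 4.19, the lemma implies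
> that the morphism `pr₁ : T → 𝒞` has finite fibres" (pp. 73–74).

## The formal route

The printed proof of 4.20 uses the Stein factorisation of `pr₂` ("We conclude that `pr₂⁻¹(x)` is
connected, for any normal point `x` of `X`"), which Mathlib lacks. We replace the connectedness
of `T_α = pr₂⁻¹(x_α)` by a pointwise statement with the same effect: **if the point
`t'_α = (c, x_α)` of `T` is isolated in its fibre `pr₂⁻¹(x_α)`, then it is the point
`t_α = (τ_α(s), σ_α(s))` of the section of `T` through the labelled points** — by Zariski's Main
Theorem `pr₂` is an open immersion near `t'_α` (`exists_isOpenImmersion_of_quasiFiniteAt`: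
`pr₂` is birational and `x_α ∈ sm(X/S)` is a normal point, `S` being normal,
`isIntegrallyClosed_stalk_of_mem_smoothLocus`), and the two resulting sections of the separated
`T → S` near `s` agree on the dense open `U`, hence at `s`. Everything else follows the text:

* 4.19: the fibres of `T → S` have dimension `≤ 1` (`GraphClosureFibreDimension.lean`), so a
  fibre point with a proper specialization in its fibre is a maximal point of the fibre, and
  there are finitely many of those;
* an infinite fibre `pr₁⁻¹(c)` (`c` closed in `𝒞_s`, to which one reduces) contains `ζ ⤳ t'`
  with `ξ = pr₂ ζ` the generic point of a component `X_j` of `X_s` ("`pr₁ : Tᵢ → 𝒞_s` constant,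
  `pr₂(Tᵢ) = X_j`");
* e): three labelled points `x_α, x_β, x_γ ∈ X_j ∩ sm(X/S)` with distinct labels (read off the
  geometric fibre, `HasThreeSmoothPoints`), and points `t'_• ∈ T` over `(c, x_•)`;
* for each label with `c ≠ c_• = τ_•(s)`: `t'_•` is not isolated in `pr₂⁻¹(x_•)`, whence a
  maximal point `d_•` of `𝒞_s` with `d_• ⤳ c`, the generic point of "`pr₁(T_•)`"; distinct labels
  give distinct `d_•` by (ii) (`pr₁` is an isomorphism near the smooth, normal point `d_•`, as
  its fibre there is finite: `subsingleton_preimage_singleton_of_finite`);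
* Case 1 (`c ∉ {c_α, c_β, c_γ}`): three components of `𝒞_s` through `c` — contradicts
  semi-stability (`IsSemiStableCurve.not_three_maximal_specializes`); Case 2 (`c = c_α`): two
  components through the smooth labelled point `c_α` — impossible
  (`eq_of_maximal_specializes_of_mem_smoothLocus`).

## References

* A. J. de Jong, *Smoothness, semi-stability and alterations*, Publ. Math. IHÉS 83 (1996),
  4.18–4.21, pp. 72–74.
-/

noncomputable section

open CategoryTheory CategoryTheory.Limits AlgebraicGeometry TopologicalSpace Topology Order

namespace Literature.AlgebraicGeometry.Resolution

universe u

/-! ## General lemmas -/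

/-- **An infinite Noetherian sober space has a proper specialization**: some irreducible
component is infinite, and its generic point specializes to its other points. [folklore] -/
theorem exists_specializes_ne_of_infinite {X : Type*} [TopologicalSpace X] [NoetherianSpace X]
    [QuasiSober X] (hX : (Set.univ : Set X).Infinite) : ∃ a b : X, a ⤳ b ∧ a ≠ b := by
  by_contra hcon
  push Not at hcon
  apply hX
  have hsub : ∀ C ∈ irreducibleComponents X, C.Subsingleton := by
    intro C hC
    have hgen := hC.1.isGenericPoint_genericPoint (isClosed_of_mem_irreducibleComponents C hC)
    intro a ha b hb
    rw [← hcon _ _ (hgen.specializes ha), ← hcon _ _ (hgen.specializes hb)]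
  have hcover : (Set.univ : Set X) ⊆ ⋃₀ irreducibleComponents X := fun x _ =>
    ⟨_, irreducibleComponent_mem_irreducibleComponents x, mem_irreducibleComponent⟩
  exact (NoetherianSpace.finite_irreducibleComponents.sUnion fun C hC => (hsub C hC).finite).subset
    hcover

/-- **A scheme of dimension `≤ 1` has no chain of three distinct points under
specialization.** [folklore] -/
theorem not_three_specializes_of_topologicalKrullDim_le_one {F : Scheme.{u}}
    (hF : topologicalKrullDim F ≤ 1) {a b e : F} (hab : a ⤳ b) (hbe : b ⤳ e) (h₁ : a ≠ b)
    (h₂ : b ≠ e) : False := by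
  have hlt₁ : b < a := by
    rw [lt_iff_le_not_ge, Scheme.le_iff_specializes, Scheme.le_iff_specializes]
    exact ⟨hab, fun h' => h₁ (hab.antisymm h').eq⟩
  have hlt₂ : e < b := by
    rw [lt_iff_le_not_ge, Scheme.le_iff_specializes, Scheme.le_iff_specializes]
    exact ⟨hbe, fun h' => h₂ (hbe.antisymm h').eq⟩
  have c := (add_le_add (Order.coheight_add_one_le hlt₁) le_rfl).trans (Order.coheight_add_one_le hlt₂)
  have h2 : (2 : ℕ∞) ≤ coheight e := by
    have : (2 : ℕ∞) ≤ coheight a + 1 + 1 := by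
      rw [add_assoc, one_add_one_eq_two]; exact le_add_self
    exact this.trans c
  have hle : ((coheight e : ℕ∞) : WithBot ℕ∞) ≤ 1 :=
    (Order.coheight_le_krullDim e).trans (le_of_eq_of_le (topologicalKrullDim_eq_krullDim_carrier F).symm hF)
  have : ((2 : ℕ∞) : WithBot ℕ∞) ≤ 1 := (WithBot.coe_le_coe.mpr h2).trans hle
  exact absurd (WithBot.coe_le_coe.mp this) (by decide)

/-- **No specialization between distinct points of `X ×_S 𝒞` with the same projections
`(x, c)`, when `c` is closed in its fibre `𝒞_{p c}`**: both points lie in the fibre of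
`pr_𝒞 : X ×_S 𝒞 → 𝒞` over `c`, which is integral over the fibre `X_{p c}` (base change of the
algebraic extension `κ(c)/κ(p c)`), and fibres of integral morphisms are discrete (Stacks 00GT).
[cite: StacksProject, Tag 00GT] -/
theorem eq_of_specializes_of_fst_eq {X S C : Scheme.{u}} (f : X ⟶ S) (p : C ⟶ S)
    [LocallyOfFiniteType p] {c : C} (hc : IsClosed ({p.asFiber c} : Set ↥(p.fiber (p c))))
    {a b : ↥(pullback f p)} (hab : a ⤳ b) (hca : pullback.snd f p a = c)
    (hcb : pullback.snd f p b = c) (hx : pullback.fst f p a = pullback.fst f p b) : a = b := by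
  obtain ⟨π, hπ, hcomp⟩ := exists_isPullback_fiber_snd f p c
  haveI := isIntegralHom_SpecMap_residueFieldMap_of_isClosed p c hc
  haveI : IsIntegralHom π := MorphismProperty.of_isPullback hπ.flip inferInstance
  have hsp : ((pullback.snd f p).fiberHomeo c).symm ⟨a, hca⟩ ⤳
      ((pullback.snd f p).fiberHomeo c).symm ⟨b, hcb⟩ :=
    (fiberHomeo_symm_specializes_iff (pullback.snd f p) hca hcb).mpr hab
  have hπeq : π (((pullback.snd f p).fiberHomeo c).symm ⟨a, hca⟩) =
      π (((pullback.snd f p).fiberHomeo c).symm ⟨b, hcb⟩) := by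
    apply (f.fiberι (p c)).isEmbedding.injective
    show (π ≫ f.fiberι (p c)) _ = (π ≫ f.fiberι (p c)) _
    rw [hcomp, Scheme.Hom.comp_apply, Scheme.Hom.comp_apply, Scheme.Hom.fiberι_fiberHomeo_symm,
      Scheme.Hom.fiberι_fiberHomeo_symm]
    exact hx
  have key := eq_of_specializes_of_isIntegralHom π hsp hπeq
  have := congrArg (fun w => ((pullback.snd f p).fiberι c w : ↥(pullback f p))) key
  simpa using this

/-- **A closed point of a fibre scheme is closed in its fibre**: no other point of the fibre is a
specialization of it. [folklore] -/
theorem forall_eq_of_isClosed_singleton_fiber {Y Z : Scheme.{u}} (g : Y ⟶ Z) {y : Z}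
    {z : ↥(g.fiber y)} (hz : IsClosed ({z} : Set ↥(g.fiber y))) :
    ∀ e : Y, g e = g (g.fiberι y z) → g.fiberι y z ⤳ e → e = g.fiberι y z := by
  intro e he hte
  have he' : g e = y := he.trans (Literature.AlgebraicGeometry.Motives.apply_fiberι g y z)
  have hzeb : z ⤳ (g.fiberHomeo y).symm ⟨e, he'⟩ := by
    rw [← (g.fiberι y).isEmbedding.specializes_iff, Scheme.Hom.fiberι_fiberHomeo_symm]
    exact hte
  have hmem : (g.fiberHomeo y).symm ⟨e, he'⟩ ∈ closure ({z} : Set ↥(g.fiber y)) :=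
    specializes_iff_mem_closure.mp hzeb
  rw [hz.closure_eq, Set.mem_singleton_iff] at hmem
  have := congrArg (fun w => (g.fiberι y w : Y)) hmem
  simpa using this

/-- **Under a closed map, points closed in their fibre map to points closed in their fibre.**
[folklore] -/
theorem forall_eq_apply_of_isClosedMap {T C S : Scheme.{u}} (pr : T ⟶ C) (p : C ⟶ S)
    (hcl : IsClosedMap pr) {t : T} (ht : ∀ e : T, p (pr e) = p (pr t) → t ⤳ e → e = t) :
    ∀ c' : C, p c' = p (pr t) → pr t ⤳ c' → c' = pr t := by
  intro c' hc' hsc'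
  have hmem : c' ∈ pr '' closure {t} := by
    rw [image_closure_singleton_of_isClosedMap pr.continuous hcl]
    exact specializes_iff_mem_closure.mp hsc'
  obtain ⟨e, he, rfl⟩ := hmem
  rw [ht e hc' (specializes_iff_mem_closure.mpr he)]

/-- **Points of a geometric fibre over the image of a section.** For `f : X → S` with a section
`σ` and a morphism `ȳ : Y → S` from a one-point scheme (e.g. a geometric point), at most one point
of `X ×_S Y` lies over `σ(S)`: these points form the image of
`S ×_X (X ×_S Y) ≅ (S ×_S Y) ≅ Y`. [folklore] -/
theorem subsingleton_preimage_fst_range_section {X S Y : Scheme.{u}} (f : X ⟶ S) (yb : Y ⟶ S)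
    [Subsingleton Y] (σ : S ⟶ X) (hσ : σ ≫ f = 𝟙 S) :
    ((pullback.fst f yb) ⁻¹' Set.range σ).Subsingleton := by
  rw [← Scheme.Pullback.range_snd]
  let e₁ := pullbackRightPullbackFstIso f yb σ
  let e₂ : pullback (σ ≫ f) yb ≅ pullback (𝟙 S) yb := pullback.congrHom hσ rfl
  let m : pullback σ (pullback.fst f yb) ⟶ Y := e₁.hom ≫ e₂.hom ≫ pullback.snd (𝟙 S) yb
  haveI : IsIso m := by
    haveI : IsIso (pullback.snd (𝟙 S) yb) := inferInstance
    infer_instance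
  haveI : Subsingleton ↥(pullback σ (pullback.fst f yb)) := m.homeomorph.injective.subsingleton
  rintro _ ⟨a, rfl⟩ _ ⟨b, rfl⟩
  rw [Subsingleton.elim a b]

/-- **The generic points of the irreducible components of a Noetherian `T₀` space form a finite
set** (they correspond injectively to the components). [folklore] -/
theorem finite_genericPoints {X : Type*} [TopologicalSpace X] [NoetherianSpace X] [T0Space X] :
    (genericPoints X).Finite := by
  refine Set.Finite.of_finite_image (f := fun x : X => closure ({x} : Set X)) ?_ ?_
  · exact NoetherianSpace.finite_irreducibleComponents.subset (by rintro _ ⟨x, hx, rfl⟩; exact hx)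
  · intro x _ y _ hxy
    have hxy' : closure ({x} : Set X) = closure {y} := hxy
    have h1 : x ⤳ y := specializes_iff_closure_subset.mpr hxy'.symm.subset
    have h2 : y ⤳ x := specializes_iff_closure_subset.mpr hxy'.subset
    exact (h1.antisymm h2).eq

/-! ## Situation 4.18: sections of `T`, birationality of `pr₂`, finiteness of maximal fibre points -/

namespace DeJong1996.ThreePointSituation

variable {X S C : Scheme.{u}} [IsIntegral S] {f : X ⟶ S} [LocallyOfFinitePresentation f] {n : ℕ}
  {σ : Fin n → (S ⟶ X)} {p : C ⟶ S} {τ : Fin n → (S ⟶ C)} {U : S.Opens}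
  {β : ((p ⁻¹ᵁ U : C.Opens) : Scheme.{u}) ⟶ (f ⁻¹ᵁ U : X.Opens)}

/-- **`pr₂ : T → X` is an isomorphism over `X_U` and `pr₂⁻¹(X_U)` is dense in `T`**: the
inverse of `β` followed by `𝒞_U → T` is a dominant section of the separated `pr₂` over `X_U`.
[cite: DeJong1996, 4.19, p. 73] -/
theorem isIso_graphClosureSnd_morphismRestrict [IsNoetherian S] (h : ThreePointSituation f σ p τ U β) :
    IsIso (graphClosureSnd f p U β h.comm ∣_ (f ⁻¹ᵁ U)) ∧
      Dense ((graphClosureSnd f p U β h.comm ⁻¹ᵁ (f ⁻¹ᵁ U) :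
        (graphClosure f p U β h.comm).Opens) : Set ↥(graphClosure f p U β h.comm)) := by
  haveI := h.isIso
  haveI := h.quasiCompact_graphMorphism
  haveI := h.isIntegral_preimage
  haveI := h.isPointedSemiStableCurve.isSemiStableCurve.isSeparated
  haveI := isReduced_graphClosure f p U β h.comm
  exact ChowLemmaProof.isIso_morphismRestrict_of_section (graphClosureSnd f p U β h.comm) (f ⁻¹ᵁ U)
    (inv β ≫ toGraphClosure f p U β h.comm)
    (by rw [Category.assoc, toGraphClosure_snd, IsIso.inv_hom_id_assoc])

/-- **"`pr₂ : T → X` […] birational"** (4.19: "We remark that these are birational, i.e.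
modifications"). [cite: DeJong1996, 4.19, p. 73] -/
theorem isBirational_graphClosureSnd [IsNoetherian S] (h : ThreePointSituation f σ p τ U β) :
    IsBirational (graphClosureSnd f p U β h.comm) := by
  haveI := h.isIntegral
  haveI := h.isCurveFibration.surjective
  obtain ⟨hiso, hdense⟩ := h.isIso_graphClosureSnd_morphismRestrict
  refine ⟨f ⁻¹ᵁ U, (f ⁻¹ᵁ U).isOpen.dense ?_, hdense, hiso⟩
  obtain ⟨s, hs⟩ := h.nonempty
  obtain ⟨x, hx⟩ := f.surjective s
  exact ⟨x, show f x ∈ U by rw [hx]; exact hs⟩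

/-- **The section `Γ_α = (τ_α, σ_α) : S → T` of `T → S` through the labelled points** ("Note that
`t_α = (τ_α(s), σ_α(s)) ∈ Z` is a point of `T_α`", 4.20): the morphism `(τ_α, σ_α) : S → 𝒞 ×_S X`
factors through the closed subscheme `T`, because `S` is reduced and its image lies in `T` — over
the dense open `U` it is `Γ_β ∘ τ_α`. [cite: DeJong1996, proof of Lemma 4.20, p. 74] -/
theorem exists_section_graphClosure [IsNoetherian S] (h : ThreePointSituation f σ p τ U β)
    (i : Fin n) : ∃ Γ : S ⟶ graphClosure f p U β h.comm,
      Γ ≫ graphClosureFst f p U β h.comm = τ i ∧ Γ ≫ graphClosureSnd f p U β h.comm = σ i := by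
  haveI := h.quasiCompact_graphMorphism
  haveI := h.isIntegral_preimage
  have hτ := h.isPointedSemiStableCurve.comp_eq_id i
  have hσ := h.comp_eq_id i
  let g : S ⟶ pullback p f := pullback.lift (τ i) (σ i) (by rw [hτ, hσ])
  -- the image of `g` lies in `T`
  have hsub : Set.range g ⊆ closure (Set.range (graphMorphism f p U β h.comm)) := by
    obtain ⟨t, ht1, ht2⟩ := h.fac i
    have hUg : U.ι ≫ g = t ≫ graphMorphism f p U β h.comm := by
      apply pullback.hom_ext
      · rw [Category.assoc, Category.assoc, pullback.lift_fst, graphMorphism_fst, ht1]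
      · rw [Category.assoc, Category.assoc, pullback.lift_snd, graphMorphism_snd, ht2]
    have h1 : g '' (U : Set S) ⊆ Set.range (graphMorphism f p U β h.comm) := by
      rintro _ ⟨s, hs, rfl⟩
      refine ⟨t ⟨s, hs⟩, ?_⟩
      have e1 : (U.ι ≫ g) ⟨s, hs⟩ = (t ≫ graphMorphism f p U β h.comm) ⟨s, hs⟩ := by rw [hUg]
      rw [Scheme.Hom.comp_apply, Scheme.Hom.comp_apply] at e1
      exact e1.symm
    have hdense : closure (U : Set S) = Set.univ := (U.isOpen.dense h.nonempty).closure_eq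
    calc Set.range g = g '' closure (U : Set S) := by rw [hdense, Set.image_univ]
      _ ⊆ closure (g '' (U : Set S)) := image_closure_subset_closure_image g.continuous
      _ ⊆ closure (Set.range (graphMorphism f p U β h.comm)) := closure_mono h1
  have hker : (graphMorphism f p U β h.comm).ker ≤ g.ker := by
    rw [ker_eq_vanishingIdeal_closure_range, ker_eq_vanishingIdeal_closure_range]
    exact Scheme.IdealSheafData.vanishingIdeal_antimono
      (show (TopologicalSpace.Closeds.closure (Set.range g) : Set ↥(pullback p f)) ⊆
        TopologicalSpace.Closeds.closure (Set.range (graphMorphism f p U β h.comm)) from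
        isClosed_closure.closure_subset_iff.mpr hsub)
  let Γ : S ⟶ graphClosure f p U β h.comm := g.toImage ≫ Scheme.IdealSheafData.inclusion hker
  have hΓ : Γ ≫ graphClosureι f p U β h.comm = g := by
    show (g.toImage ≫ Scheme.IdealSheafData.inclusion hker) ≫
      (graphMorphism f p U β h.comm).ker.subschemeι = g
    rw [Category.assoc, Scheme.IdealSheafData.inclusion_subschemeι]
    exact g.toImage_imageι
  refine ⟨Γ, ?_, ?_⟩
  · show Γ ≫ graphClosureι f p U β h.comm ≫ pullback.fst p f = τ i
    rw [← Category.assoc, hΓ, pullback.lift_fst]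
  · show Γ ≫ graphClosureι f p U β h.comm ≫ pullback.snd p f = σ i
    rw [← Category.assoc, hΓ, pullback.lift_snd]

/-- The labelled points `τᵢ(s)` lie in the smooth locus of `𝒞 → S`.
[cite: DeJong1996, 4.20, p. 74] -/
theorem apply_section_mem_smoothLocus (h : ThreePointSituation f σ p τ U β)
    [LocallyOfFinitePresentation p] (i : Fin n) (s : S) : τ i s ∈ p.smoothLocus := by
  obtain ⟨V, hV, hsm⟩ := h.isPointedSemiStableCurve.exists_smooth i
  haveI := hsm
  have hmem : τ i s ∈ V := hV ⟨s, rfl⟩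
  have : (⟨τ i s, hmem⟩ : V) ∈ (V.ι ≫ p).smoothLocus := by
    rw [Scheme.Hom.smoothLocus_eq_top]; trivial
  rw [← Scheme.Hom.preimage_smoothLocus_eq] at this
  exact this

/-- Points of the smooth locus of `X → S` are normal (`S` normal, `X` integral):
`isIntegrallyClosed_stalk_of_mem_smoothLocus`. [cite: DeJong1996, proof of Lemma 4.20, p. 73] -/
theorem isIntegrallyClosed_stalk_of_mem_smoothLocus_source (h : ThreePointSituation f σ p τ U β)
    (hS : ∀ s : S, IsIntegrallyClosed (S.presheaf.stalk s)) {x : X} (hx : x ∈ f.smoothLocus) :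
    IsIntegrallyClosed (X.presheaf.stalk x) := by
  haveI := h.isIntegral
  haveI := h.isProper
  haveI := h.isCurveFibration.surjective
  exact isIntegrallyClosed_stalk_of_mem_smoothLocus f hS hx

/-- Points of the smooth locus of `𝒞 → S` are normal. [cite: DeJong1996, 4.21, p. 74] -/
theorem isIntegrallyClosed_stalk_of_mem_smoothLocus_model (h : ThreePointSituation f σ p τ U β)
    [LocallyOfFinitePresentation p] (hS : ∀ s : S, IsIntegrallyClosed (S.presheaf.stalk s))
    {c : C} (hc : c ∈ p.smoothLocus) : IsIntegrallyClosed (C.presheaf.stalk c) := by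
  haveI := h.isIntegral_model
  haveI := h.isProper_model
  haveI := h.isPointedSemiStableCurve.isSemiStableCurve.isDominant
  exact isIntegrallyClosed_stalk_of_mem_smoothLocus p hS hc

/-- **Maximal fibre points are finite in number**: the points `t` of a fibre `T_s` of `T → S`
having a proper specialization inside `T_s` are maximal points of `T_s` (the fibres have no
chains of three points, `not_three_specializes_fiber_graphClosure`), i.e. generic points of
irreducible components of the Noetherian fibre scheme, of which there are finitely many.
[cite: DeJong1996, 4.19, p. 73] -/
theorem finite_setOf_specializes_ne [IsNoetherian S] (h : ThreePointSituation f σ p τ U β)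
    (hX : Flat f) (hT : Flat (graphClosureMap f p U β h.comm)) (s : S) :
    {t : ↥(graphClosure f p U β h.comm) | graphClosureMap f p U β h.comm t = s ∧
      ∃ e, graphClosureMap f p U β h.comm e = s ∧ t ⤳ e ∧ t ≠ e}.Finite := by
  haveI := h.isProper
  haveI := h.isProper_model
  set π := graphClosureMap f p U β h.comm with hπ
  haveI : LocallyOfFiniteType (π.fiberToSpecResidueField s) :=
    haveI := h.locallyOfFiniteType_graphClosureMap
    MorphismProperty.pullback_snd (P := @LocallyOfFiniteType) _ _ inferInstance
  haveI : IsLocallyNoetherian (π.fiber s) :=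
    LocallyOfFiniteType.isLocallyNoetherian (f := π.fiberToSpecResidueField s)
  haveI : IsNoetherian (π.fiber s) := {}
  have hfin : (π.fiberι s '' genericPoints ↥(π.fiber s)).Finite := finite_genericPoints.image _
  refine hfin.subset ?_
  rintro t ⟨ht, e, he, hte, hne⟩
  refine ⟨(π.fiberHomeo s).symm ⟨t, ht⟩, ?_, by simp⟩
  refine fiberHomeo_symm_mem_genericPoints π ht (fun e' he' he't => ?_)
  by_contra hne'
  exact h.not_three_specializes_fiber_graphClosure hX hT he't hte hne' hne (he'.trans he.symm)

/-! ## Points of `T` over a pair `(c, x)` -/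

/-- **Two points of `T` over the same pair `(c, x) ∈ 𝒞 × X`, with `c` closed in its fibre, and
one specializing to the other, are equal** (`eq_of_specializes_of_fst_eq` transported to
`T ⊆ 𝒞 ×_S X ≅ X ×_S 𝒞`). [folklore] -/
theorem eq_of_specializes_of_proj_eq [IsNoetherian S] (h : ThreePointSituation f σ p τ U β)
    {c : C} (hc : IsClosed ({p.asFiber c} : Set ↥(p.fiber (p c))))
    {a b : ↥(graphClosure f p U β h.comm)} (hab : a ⤳ b)
    (ha : graphClosureFst f p U β h.comm a = c) (hb : graphClosureFst f p U β h.comm b = c)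
    (hx : graphClosureSnd f p U β h.comm a = graphClosureSnd f p U β h.comm b) : a = b := by
  haveI := h.isPointedSemiStableCurve.isSemiStableCurve.locallyOfFinitePresentation
  let sy := (pullbackSymmetry p f).hom
  have key : sy (graphClosureι f p U β h.comm a) = sy (graphClosureι f p U β h.comm b) := by
    refine eq_of_specializes_of_fst_eq f p hc
      ((hab.map (graphClosureι f p U β h.comm).continuous).map sy.continuous) ?_ ?_ ?_
    · show (sy ≫ pullback.snd f p) _ = c
      rw [pullbackSymmetry_hom_comp_snd]; exact ha
    · show (sy ≫ pullback.snd f p) _ = c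
      rw [pullbackSymmetry_hom_comp_snd]; exact hb
    · show (sy ≫ pullback.fst f p) _ = (sy ≫ pullback.fst f p) _
      rw [pullbackSymmetry_hom_comp_fst]; exact hx
  apply (graphClosureι f p U β h.comm).isClosedEmbedding.injective
  exact (pullbackSymmetry p f).hom.homeomorph.injective key

/-- `p (pr₁ t) = f (pr₂ t)`. [folklore] -/
theorem apply_graphClosureFst_eq (h : ThreePointSituation f σ p τ U β)
    (t : ↥(graphClosure f p U β h.comm)) :
    p (graphClosureFst f p U β h.comm t) = f (graphClosureSnd f p U β h.comm t) := by
  show (graphClosureFst f p U β h.comm ≫ p) t = (graphClosureSnd f p U β h.comm ≫ f) t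
  rw [graphClosureSnd_comp]

/-- `π t = p (pr₁ t)`. [folklore] -/
theorem graphClosureMap_apply (h : ThreePointSituation f σ p τ U β)
    (t : ↥(graphClosure f p U β h.comm)) :
    graphClosureMap f p U β h.comm t = p (graphClosureFst f p U β h.comm t) := rfl

/-! ## 4.20–4.21: an infinite fibre of `pr₁` over a point `c` closed in `𝒞_s` -/

/-- **"Suppose that `pr₁ : Tᵢ → 𝒞_s` is constant […] `pr₂(Tᵢ) = X_j`"**: if the fibre of
`pr₁ : T → 𝒞` over a point `c` closed in `𝒞_s` is infinite, it contains a point `ζ` whose image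
`ξ = pr₂ ζ` is a maximal point of `X_s` (the generic point of a component `X_j`). Indeed the
infinite Noetherian fibre has a proper specialization `ζ ⤳ t'`; `pr₂ ζ ≠ pr₂ t'`
(`eq_of_specializes_of_proj_eq`), and `X_s` has no chains of three points.
[cite: DeJong1996, Lemma 4.20 (i), p. 73] -/
theorem exists_maximal_snd_of_infinite [IsNoetherian S] (h : ThreePointSituation f σ p τ U β)
    {c : C} (hc : ∀ e : C, p e = p c → c ⤳ e → e = c)
    (hinf : (graphClosureFst f p U β h.comm ⁻¹' {c}).Infinite) :
    ∃ ζ : ↥(graphClosure f p U β h.comm), graphClosureFst f p U β h.comm ζ = c ∧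
      ∀ e : X, f e = p c → e ⤳ graphClosureSnd f p U β h.comm ζ →
        e = graphClosureSnd f p U β h.comm ζ := by
  haveI := h.isProper
  set pr₁ := graphClosureFst f p U β h.comm with hpr₁
  haveI : LocallyOfFiniteType (pr₁.fiberToSpecResidueField c) :=
    MorphismProperty.pullback_snd (P := @LocallyOfFiniteType) _ _ inferInstance
  haveI : IsLocallyNoetherian (pr₁.fiber c) :=
    LocallyOfFiniteType.isLocallyNoetherian (f := pr₁.fiberToSpecResidueField c)
  haveI : IsNoetherian (pr₁.fiber c) := {}
  have huniv : (Set.univ : Set ↥(pr₁.fiber c)).Infinite := by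
    haveI : Infinite ↥(pr₁ ⁻¹' {c}) := hinf.to_subtype
    haveI : Infinite ↥(pr₁.fiber c) := (pr₁.fiberHomeo c).toEquiv.infinite_iff.mpr inferInstance
    exact Set.infinite_univ
  obtain ⟨a, b, hab, hne⟩ := exists_specializes_ne_of_infinite huniv
  have hca : pr₁ (pr₁.fiberι c a) = c := Literature.AlgebraicGeometry.Motives.apply_fiberι pr₁ c a
  have hcb : pr₁ (pr₁.fiberι c b) = c := Literature.AlgebraicGeometry.Motives.apply_fiberι pr₁ c b
  have hab' : pr₁.fiberι c a ⤳ pr₁.fiberι c b := hab.map (pr₁.fiberι c).continuous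
  have hne' : pr₁.fiberι c a ≠ pr₁.fiberι c b := fun e => hne ((pr₁.fiberι c).isEmbedding.injective e)
  have hcl : IsClosed ({p.asFiber c} : Set ↥(p.fiber (p c))) := isClosed_singleton_asFiber p hc
  -- `pr₂ ζ ≠ pr₂ t'`
  have hx : graphClosureSnd f p U β h.comm (pr₁.fiberι c a) ≠
      graphClosureSnd f p U β h.comm (pr₁.fiberι c b) :=
    fun hx => hne' (h.eq_of_specializes_of_proj_eq hcl hab' hca hcb hx)
  refine ⟨pr₁.fiberι c a, hca, fun e he hesp => ?_⟩
  by_contra hne''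
  -- a chain `e ⤳ pr₂ ζ ⤳ pr₂ t'` in `X_s`
  have hF : topologicalKrullDim ↥(f.fiber (p c)) ≤ 1 :=
    Literature.AlgebraicGeometry.Dimension.topologicalKrullDim_le_of_forall_mem_irreducibleComponents
      _ 1 (fun C hC => le_of_eq (h.isCurveFibration.topologicalKrullDim_eq_one _ C hC))
  have hfa : f (graphClosureSnd f p U β h.comm (pr₁.fiberι c a)) = p c := by
    rw [← h.apply_graphClosureFst_eq, hca]
  have hfb : f (graphClosureSnd f p U β h.comm (pr₁.fiberι c b)) = p c := by
    rw [← h.apply_graphClosureFst_eq, hcb]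
  refine not_three_specializes_of_topologicalKrullDim_le_one hF
    ((fiberHomeo_symm_specializes_iff f he hfa).mpr hesp)
    ((fiberHomeo_symm_specializes_iff f hfa hfb).mpr
      (hab'.map (graphClosureSnd f p U β h.comm).continuous)) ?_ ?_
  · intro e1
    exact hne'' (by simpa using congrArg (fun w => (f.fiberι (p c) w : X)) e1)
  · intro e1
    exact hx (by simpa using congrArg (fun w => (f.fiberι (p c) w : X)) e1)

/-- **A point `t'` of `T` over `(c, x)` which is not isolated in `pr₂⁻¹(x)` lies on a "vertical
curve": there is `g ⤳ t'`, `g ≠ t'`, with `pr₂ g = x`, whose image `d = pr₁ g` is a maximal point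
of `𝒞_s` specializing to, and different from, `c`** ("`pr₁(T_α)` has dimension 1 as it connects
`c` […] with […]", 4.20, Case 1). The point of the fibre `pr₂⁻¹(x)` defined by `t'` is closed
(`eq_of_specializes_of_proj_eq`) and not open (Mathlib: quasi-finite at `t'` iff open in the
fibre), hence not maximal (`isOpen_singleton_of_isClosed_of_mem_genericPoints`); `d ≠ c` again by
`eq_of_specializes_of_proj_eq`, and `d` is maximal as `𝒞_s` has no chains of three points.
[cite: DeJong1996, Lemma 4.20, Case 1, p. 74] -/
theorem exists_maximal_fst_of_not_quasiFiniteAt [IsNoetherian S]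
    (h : ThreePointSituation f σ p τ U β) {c : C} (hc : ∀ e : C, p e = p c → c ⤳ e → e = c)
    {t' : ↥(graphClosure f p U β h.comm)} (ht' : graphClosureFst f p U β h.comm t' = c)
    (hq : ¬ (graphClosureSnd f p U β h.comm).QuasiFiniteAt t') :
    ∃ g : ↥(graphClosure f p U β h.comm), g ≠ t' ∧
      graphClosureSnd f p U β h.comm g = graphClosureSnd f p U β h.comm t' ∧
      graphClosureFst f p U β h.comm g ⤳ c ∧ graphClosureFst f p U β h.comm g ≠ c ∧
      p (graphClosureFst f p U β h.comm g) = p c ∧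
      ∀ e : C, p e = p c → e ⤳ graphClosureFst f p U β h.comm g →
        e = graphClosureFst f p U β h.comm g := by
  haveI := h.isProper_model
  have hsst := h.isPointedSemiStableCurve.isSemiStableCurve
  set pr₂ := graphClosureSnd f p U β h.comm with hpr₂
  have hcl : IsClosed ({p.asFiber c} : Set ↥(p.fiber (p c))) := isClosed_singleton_asFiber p hc
  -- the point of the fibre `pr₂⁻¹(x)` defined by `t'` is closed …
  have hcl' : IsClosed ({pr₂.asFiber t'} : Set ↥(pr₂.fiber (pr₂ t'))) := by
    refine isClosed_singleton_asFiber pr₂ (fun e he hte => ?_)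
    have h1 : c ⤳ graphClosureFst f p U β h.comm e := ht' ▸ hte.map (graphClosureFst f p U β h.comm).continuous
    have h2 : p (graphClosureFst f p U β h.comm e) = p c := by
      rw [h.apply_graphClosureFst_eq, he, ← h.apply_graphClosureFst_eq, ht']
    exact (h.eq_of_specializes_of_proj_eq hcl hte ht' (hc _ h2 h1) he.symm).symm
  -- … and not open, hence not maximal
  haveI : LocallyOfFiniteType (pr₂.fiberToSpecResidueField (pr₂ t')) :=
    MorphismProperty.pullback_snd (P := @LocallyOfFiniteType) _ _ inferInstance
  haveI : IsLocallyNoetherian (pr₂.fiber (pr₂ t')) :=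
    LocallyOfFiniteType.isLocallyNoetherian (f := pr₂.fiberToSpecResidueField (pr₂ t'))
  haveI : IsNoetherian (pr₂.fiber (pr₂ t')) := {}
  have hnotgen : pr₂.asFiber t' ∉ genericPoints ↥(pr₂.fiber (pr₂ t')) := fun hgen =>
    hq (Scheme.Hom.quasiFiniteAt_iff_isOpen_singleton_asFiber.mpr
      (isOpen_singleton_of_isClosed_of_mem_genericPoints hcl' hgen))
  rw [mem_genericPoints_iff_forall_specializes] at hnotgen
  push Not at hnotgen
  obtain ⟨gb, hgb, hgbne⟩ := hnotgen
  -- the point `g`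
  set g := pr₂.fiberι (pr₂ t') gb with hg
  have hgt' : g ⤳ t' := by
    have := hgb.map (pr₂.fiberι (pr₂ t')).continuous
    rwa [Scheme.Hom.fiberι_asFiber] at this
  have hgne : g ≠ t' := by
    intro e
    apply hgbne
    apply (pr₂.fiberι (pr₂ t')).isEmbedding.injective
    rw [← hg, e, Scheme.Hom.fiberι_asFiber]
  have hgx : pr₂ g = pr₂ t' := Literature.AlgebraicGeometry.Motives.apply_fiberι pr₂ _ gb
  have hdc : graphClosureFst f p U β h.comm g ⤳ c := ht' ▸ hgt'.map (graphClosureFst f p U β h.comm).continuous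
  have hpd : p (graphClosureFst f p U β h.comm g) = p c := by
    rw [h.apply_graphClosureFst_eq, hgx, ← h.apply_graphClosureFst_eq, ht']
  have hdne : graphClosureFst f p U β h.comm g ≠ c := fun hd =>
    hgne (h.eq_of_specializes_of_proj_eq hcl hgt' hd ht' hgx)
  refine ⟨g, hgne, hgx, hdc, hdne, hpd, fun e he hed => ?_⟩
  -- maximality: no chain `e ⤳ d ⤳ c` in `𝒞_s`
  by_contra hne
  refine not_three_specializes_of_topologicalKrullDim_le_one
    (le_of_eq (hsst.topologicalKrullDim_fiber_eq_one (p c)))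
    ((fiberHomeo_symm_specializes_iff p he hpd).mpr hed)
    ((fiberHomeo_symm_specializes_iff p hpd rfl).mpr hdc) ?_ ?_
  · intro e1
    exact hne (by simpa using congrArg (fun w => (p.fiberι (p c) w : C)) e1)
  · intro e1
    exact hdne (by simpa using congrArg (fun w => (p.fiberι (p c) w : C)) e1)

/-- **(ii) of Lemma 4.20 in the form used: the fibre of `pr₁` over a maximal point `d` of `𝒞_s`
with a proper specialization in `𝒞_s` is a single point.** Its points have proper
specializations in their fibre (`pr₁` is closed), so they are finitely many
(`finite_setOf_specializes_ne`); `d ∈ sm(𝒞/S)` (`IsSemiStableCurve.mem_smoothLocus_of_maximal`)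
is a normal point of `𝒞` (`S` normal), and a proper birational morphism is an isomorphism near a
normal point with finite fibre (`subsingleton_preimage_singleton_of_finite`).
[cite: DeJong1996, Lemma 4.20 (ii), p. 73] -/
theorem subsingleton_preimage_graphClosureFst [IsNoetherian S] (h : ThreePointSituation f σ p τ U β)
    (hS : ∀ s : S, IsIntegrallyClosed (S.presheaf.stalk s)) (hX : Flat f)
    (hT : Flat (graphClosureMap f p U β h.comm)) {d c : C} (hdc : d ⤳ c) (hne : d ≠ c)
    (hpc : p c = p d) (hmax : ∀ e : C, p e = p d → e ⤳ d → e = d) :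
    (graphClosureFst f p U β h.comm ⁻¹' {d}).Subsingleton := by
  haveI := h.isProper
  haveI := h.isIntegral_model
  haveI := h.isIntegral_graphClosure
  haveI := h.isPointedSemiStableCurve.isSemiStableCurve.locallyOfFinitePresentation
  have hsst := h.isPointedSemiStableCurve.isSemiStableCurve
  have hfin : (graphClosureFst f p U β h.comm ⁻¹' {d}).Finite := by
    refine (h.finite_setOf_specializes_ne hX hT (p d)).subset (fun t ht => ?_)
    have ht : graphClosureFst f p U β h.comm t = d := ht
    refine ⟨by rw [h.graphClosureMap_apply, ht], ?_⟩
    -- a point `e ∈ cl{t}` over `c`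
    have hmem : c ∈ graphClosureFst f p U β h.comm '' closure {t} := by
      rw [image_closure_singleton_of_isClosedMap (graphClosureFst f p U β h.comm).continuous
        (graphClosureFst f p U β h.comm).isClosedMap, ht]
      exact specializes_iff_mem_closure.mp hdc
    obtain ⟨e, he, hec⟩ := hmem
    refine ⟨e, by rw [h.graphClosureMap_apply, hec, hpc], specializes_iff_mem_closure.mpr he, ?_⟩
    intro hte
    rw [← hte, ht] at hec
    exact hne hec
  have hdsm : d ∈ p.smoothLocus := hsst.mem_smoothLocus_of_maximal hmax
  exact subsingleton_preimage_singleton_of_finite (graphClosureFst f p U β h.comm)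
    h.isBirational_graphClosureFst p.smoothLocus
    (fun y hy => h.isIntegrallyClosed_stalk_of_mem_smoothLocus_model hS hy) hdsm hfin

/-- `T → S` is separated. [folklore] -/
theorem isSeparated_graphClosureMap (h : ThreePointSituation f σ p τ U β) :
    IsSeparated (graphClosureMap f p U β h.comm) := by
  haveI := h.isSeparated
  haveI := h.isPointedSemiStableCurve.isSemiStableCurve.isSeparated
  delta graphClosureMap
  infer_instance

/-- **The replacement for the connectedness of `T_α = pr₂⁻¹(x_α)`: a point `t'` of `T` over the
labelled, smooth point `x = σᵢ(s)` which is isolated in its fibre `pr₂⁻¹(x)` is the point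
`Γᵢ(s)` of the section of `T` through `(τᵢ(s), σᵢ(s))`.** By Zariski's Main Theorem `pr₂` — which
is separated, of finite type and birational — restricts to an open immersion `j` on an open
neighbourhood `Ω` of `t'` (`exists_isOpenImmersion_of_quasiFiniteAt`; `x ∈ sm(X/S)` is a normal
point, `S` being normal). Over the open `W' = σᵢ⁻¹(j(Ω)) ∋ s` of `S` we then have two sections of
the separated `T → S`: `j⁻¹ ∘ σᵢ` and `Γᵢ`. Followed by `pr₂` both are `σᵢ`, so they agree over
`W' ∩ U`, where `pr₂` is a monomorphism (`isIso_graphClosureSnd_morphismRestrict`); `W'` being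
reduced and `W' ∩ U` dense they agree (Mathlib `ext_of_isDominant_of_isSeparated`), in particular
at `s`: `t' = Γᵢ(s)`. [cite: DeJong1996, Lemma 4.20, Cases 1–2, p. 74] -/
theorem eq_section_apply_of_quasiFiniteAt [IsNoetherian S] (h : ThreePointSituation f σ p τ U β)
    (hS : ∀ s : S, IsIntegrallyClosed (S.presheaf.stalk s)) {i : Fin n}
    {Γ : S ⟶ graphClosure f p U β h.comm} (hΓ₂ : Γ ≫ graphClosureSnd f p U β h.comm = σ i) {s : S}
    (hx : σ i s ∈ f.smoothLocus) {t' : ↥(graphClosure f p U β h.comm)}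
    (ht' : graphClosureSnd f p U β h.comm t' = σ i s)
    (hq : (graphClosureSnd f p U β h.comm).QuasiFiniteAt t') : t' = Γ s := by
  haveI := h.isIntegral
  haveI := h.isIntegral_graphClosure
  haveI := h.isProper
  haveI := h.isProper_model
  haveI := h.isPointedSemiStableCurve.isSemiStableCurve.isSeparated
  haveI := h.isSeparated_graphClosureMap
  have hσf : σ i ≫ f = 𝟙 S := h.comp_eq_id i
  -- Zariski's Main Theorem: `pr₂` is an open immersion on some `Ω ∋ t'`
  obtain ⟨Ω, htΩ, hΩ⟩ := exists_isOpenImmersion_of_quasiFiniteAt (graphClosureSnd f p U β h.comm)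
    h.isBirational_graphClosureSnd f.smoothLocus
    (fun y hy => h.isIntegrallyClosed_stalk_of_mem_smoothLocus_source hS hy)
    (show graphClosureSnd f p U β h.comm t' ∈ f.smoothLocus by rw [ht']; exact hx) hq
  haveI := hΩ
  -- the open `W' ∋ s` of `S` and the point `s₀`
  let W' : S.Opens := σ i ⁻¹ᵁ (Ω.ι ≫ graphClosureSnd f p U β h.comm).opensRange
  have hsW' : s ∈ W' := ⟨⟨t', htΩ⟩, by rw [Scheme.Hom.comp_apply]; exact ht'⟩
  haveI : Nonempty W' := ⟨⟨s, hsW'⟩⟩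
  haveI : IsIntegral W' := isIntegral_of_isOpenImmersion W'.ι
  -- the section `a = j⁻¹ ∘ σᵢ` over `W'`
  have hrange : Set.range (W'.ι ≫ σ i) ⊆ Set.range (Ω.ι ≫ graphClosureSnd f p U β h.comm) := by
    rintro _ ⟨w, rfl⟩
    exact w.2
  let a₀ := IsOpenImmersion.lift (Ω.ι ≫ graphClosureSnd f p U β h.comm) (W'.ι ≫ σ i) hrange
  have ha₀ : a₀ ≫ Ω.ι ≫ graphClosureSnd f p U β h.comm = W'.ι ≫ σ i := IsOpenImmersion.lift_fac _ _ _
  let a : (W' : Scheme.{u}) ⟶ graphClosure f p U β h.comm := a₀ ≫ Ω.ι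
  have ha2 : a ≫ graphClosureSnd f p U β h.comm = W'.ι ≫ σ i := by rw [Category.assoc, ha₀]
  -- the section `b = Γᵢ` over `W'`
  let b : (W' : Scheme.{u}) ⟶ graphClosure f p U β h.comm := W'.ι ≫ Γ
  have hb2 : b ≫ graphClosureSnd f p U β h.comm = W'.ι ≫ σ i := by rw [Category.assoc, hΓ₂]
  -- both are sections of `T → S` over `W'`
  have hπ : a ≫ graphClosureMap f p U β h.comm = b ≫ graphClosureMap f p U β h.comm := by
    rw [graphClosureMap_eq, ← Category.assoc, ha2, ← Category.assoc, hb2]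
  -- the dense open `V = W' ∩ U` of `W'`
  let V : (W' : Scheme.{u}).Opens := W'.ι ⁻¹ᵁ U
  have hVne : (V : Set W').Nonempty := by
    obtain ⟨y, hyW, hyU⟩ := nonempty_preirreducible_inter W'.isOpen U.isOpen ⟨s, hsW'⟩ h.nonempty
    exact ⟨⟨y, hyW⟩, hyU⟩
  haveI : IsDominant V.ι := AlgebraicGeometry.Opens.isDominant_ι (V.isOpen.dense hVne)
  -- `a` and `b` agree on `V`: there `pr₂` is a monomorphism
  have hV : V.ι ≫ a = V.ι ≫ b := by
    obtain ⟨hiso, -⟩ := h.isIso_graphClosureSnd_morphismRestrict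
    haveI := hiso
    -- both land in `pr₂⁻¹(X_U)`
    have hland : ∀ {k : (W' : Scheme.{u}) ⟶ graphClosure f p U β h.comm},
        k ≫ graphClosureSnd f p U β h.comm = W'.ι ≫ σ i →
        Set.range (V.ι ≫ k) ⊆ Set.range (graphClosureSnd f p U β h.comm ⁻¹ᵁ (f ⁻¹ᵁ U)).ι := by
      intro k hk
      rw [Scheme.Opens.range_ι]
      rintro _ ⟨v, rfl⟩
      show f (graphClosureSnd f p U β h.comm (k (V.ι v))) ∈ U
      have h1 : (k ≫ graphClosureSnd f p U β h.comm) (V.ι v) = (W'.ι ≫ σ i) (V.ι v) := by rw [hk]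
      rw [Scheme.Hom.comp_apply] at h1
      rw [h1, ← Scheme.Hom.comp_apply, Category.assoc, hσf, Category.comp_id]
      exact v.2
    let a' := IsOpenImmersion.lift (graphClosureSnd f p U β h.comm ⁻¹ᵁ (f ⁻¹ᵁ U)).ι (V.ι ≫ a)
      (hland ha2)
    let b' := IsOpenImmersion.lift (graphClosureSnd f p U β h.comm ⁻¹ᵁ (f ⁻¹ᵁ U)).ι (V.ι ≫ b)
      (hland hb2)
    have ha' : a' ≫ (graphClosureSnd f p U β h.comm ⁻¹ᵁ (f ⁻¹ᵁ U)).ι = V.ι ≫ a :=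
      IsOpenImmersion.lift_fac _ _ _
    have hb' : b' ≫ (graphClosureSnd f p U β h.comm ⁻¹ᵁ (f ⁻¹ᵁ U)).ι = V.ι ≫ b :=
      IsOpenImmersion.lift_fac _ _ _
    have key : a' ≫ (graphClosureSnd f p U β h.comm ∣_ (f ⁻¹ᵁ U)) =
        b' ≫ (graphClosureSnd f p U β h.comm ∣_ (f ⁻¹ᵁ U)) := by
      rw [← cancel_mono (f ⁻¹ᵁ U).ι]
      calc (a' ≫ (graphClosureSnd f p U β h.comm ∣_ (f ⁻¹ᵁ U))) ≫ (f ⁻¹ᵁ U).ι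
          = a' ≫ (graphClosureSnd f p U β h.comm ⁻¹ᵁ (f ⁻¹ᵁ U)).ι ≫
              graphClosureSnd f p U β h.comm := by rw [Category.assoc, morphismRestrict_ι]
        _ = (V.ι ≫ a) ≫ graphClosureSnd f p U β h.comm := by rw [← Category.assoc, ha']
        _ = V.ι ≫ W'.ι ≫ σ i := by rw [Category.assoc, ha2]
        _ = (V.ι ≫ b) ≫ graphClosureSnd f p U β h.comm := by rw [Category.assoc, hb2]
        _ = b' ≫ (graphClosureSnd f p U β h.comm ⁻¹ᵁ (f ⁻¹ᵁ U)).ι ≫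
              graphClosureSnd f p U β h.comm := by rw [← hb', Category.assoc]
        _ = (b' ≫ (graphClosureSnd f p U β h.comm ∣_ (f ⁻¹ᵁ U))) ≫ (f ⁻¹ᵁ U).ι := by
              rw [Category.assoc, morphismRestrict_ι]
    rw [cancel_mono] at key
    rw [← ha', ← hb', key]
  have hab : a = b := ext_of_isDominant_of_isSeparated (graphClosureMap f p U β h.comm) hπ V.ι hV
  -- evaluate at `s`
  have e1 := congrArg (fun k : (W' : Scheme.{u}) ⟶ graphClosure f p U β h.comm => k ⟨s, hsW'⟩) hab
  simp only [a, b, Scheme.Hom.comp_apply] at e1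
  have e2 : a₀ ⟨s, hsW'⟩ = ⟨t', htΩ⟩ := by
    apply (Ω.ι ≫ graphClosureSnd f p U β h.comm).isOpenEmbedding.injective
    have := congrArg (fun k : (W' : Scheme.{u}) ⟶ X => k ⟨s, hsW'⟩) ha₀
    simp only [Scheme.Hom.comp_apply] at this
    rw [Scheme.Hom.comp_apply, this, Scheme.Hom.comp_apply]
    exact ht'.symm
  rw [e2] at e1
  exact e1

/-- **e): three labelled smooth points on the component `X_j = cl{ξ}` of `X_s`, with distinct
labels** ("Let `{α, β, γ} ⊂ {1, …, n}` be such that `x_α = σ_α(s)`, `x_β = σ_β(s)` and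
`x_γ = σ_γ(s)` are distinct, lie on `X_j` and in `sm(X/S)`. Such a triple exists by e)"). The
hypothesis e) (`HasThreeSmoothPoints`) is about the geometric fibre `X_s̄ = X_s ⊗ K̄`: lift the
maximal point `ξ` of `X_s` to a generic point of `X_s̄` (flat, integral projection), take three
points of its component over `sm(X/S) ∩ ⋃ σᵢ(S)`; their images are `σᵢ(s)` for three labels,
pairwise distinct since at most one point of `X_s̄` lies over `σᵢ(S)`
(`subsingleton_preimage_fst_range_section`). [cite: DeJong1996, Lemma 4.20, p. 73] -/
theorem exists_three_labels [IsNoetherian S] (h : ThreePointSituation f σ p τ U β) {s : S} {ξ : X}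
    (hξs : f ξ = s) (hξmax : ∀ e : X, f e = s → e ⤳ ξ → e = ξ) :
    ∃ i j k : Fin n, i ≠ j ∧ i ≠ k ∧ j ≠ k ∧ σ i s ≠ σ j s ∧ σ i s ≠ σ k s ∧ σ j s ≠ σ k s ∧
      (ξ ⤳ σ i s ∧ σ i s ∈ f.smoothLocus) ∧ (ξ ⤳ σ j s ∧ σ j s ∈ f.smoothLocus) ∧
      (ξ ⤳ σ k s ∧ σ k s ∈ f.smoothLocus) := by
  haveI := h.isProper
  let K := S.residueField s
  let Kbar := AlgebraicClosure K
  let jK : Spec (CommRingCat.of Kbar) ⟶ Spec K := Spec.map (CommRingCat.ofHom (algebraMap K Kbar))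
  let yb : Spec (CommRingCat.of Kbar) ⟶ S := jK ≫ S.fromSpecResidueField s
  let q := f.fiberToSpecResidueField s
  haveI : Flat jK := flat_SpecMap_algebraMap_of_field K Kbar
  haveI : IsIntegralHom jK := isIntegralHom_SpecMap_algebraMap_of_isAlgebraic K Kbar
  -- the projection `X_s̄ → X_s`
  let e : pullback q jK ≅ pullback f yb := pullbackLeftPullbackSndIso f (S.fromSpecResidueField s) jK
  let πb : pullback f yb ⟶ f.fiber s := e.inv ≫ pullback.fst q jK
  haveI : IsIntegralHom (pullback.fst q jK) := MorphismProperty.pullback_fst _ _ inferInstance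
  haveI : IsIntegralHom πb := MorphismProperty.comp_mem _ _ _ inferInstance inferInstance
  haveI : Flat πb := inferInstance
  haveI : Surjective πb := inferInstance
  have hπb : πb ≫ f.fiberι s = pullback.fst f yb := by
    show (e.inv ≫ pullback.fst q jK) ≫ pullback.fst f (S.fromSpecResidueField s) = _
    rw [Category.assoc]
    exact pullbackLeftPullbackSndIso_inv_fst f (S.fromSpecResidueField s) jK
  have hyb : ∀ w, yb w = s := fun w => Scheme.fromSpecResidueField_apply s _
  -- lift `ξ` to a generic point `ξt` of the geometric fibre
  have hξgen := fiberHomeo_symm_mem_genericPoints f hξs hξmax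
  obtain ⟨w, hw⟩ := πb.surjective ((f.fiberHomeo s).symm ⟨ξ, hξs⟩)
  obtain ⟨ξt, hξtgen, -, hξt⟩ := exists_mem_genericPoints_lift πb w hξgen (by rw [hw])
  have hfst_ξt : pullback.fst f yb ξt = ξ := by
    rw [← hπb, Scheme.Hom.comp_apply, hξt, Scheme.Hom.fiberι_fiberHomeo_symm]
  -- three points of its component over `sm(X/S) ∩ Z`
  have h3 := h.hasThreeSmoothPoints Kbar yb (closure {ξt}) hξtgen
  obtain ⟨t3, ht3, ht3card⟩ := Set.exists_subset_encard_eq h3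
  obtain ⟨z₁, z₂, z₃, h12, h13, h23, rfl⟩ := Set.encard_eq_three.mp ht3card
  have hlab : ∀ z ∈ ({z₁, z₂, z₃} : Set ↥(pullback f yb)), ∃ l : Fin n,
      pullback.fst f yb z = σ l s ∧ ξ ⤳ σ l s ∧ σ l s ∈ f.smoothLocus := by
    intro z hz
    obtain ⟨hzcl, hzsm, hzZ⟩ := ht3 hz
    obtain ⟨l, s', hs'⟩ := Set.mem_iUnion.mp hzZ
    have hfz : f (pullback.fst f yb z) = s := by
      rw [← Scheme.Hom.comp_apply, pullback.condition, Scheme.Hom.comp_apply, hyb]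
    have hs's : s' = s := by
      have := congrArg f hs'
      rwa [← Scheme.Hom.comp_apply, h.comp_eq_id, hfz] at this
    subst hs's
    refine ⟨l, hs'.symm, ?_, hs' ▸ hzsm⟩
    have := (specializes_iff_mem_closure.mpr hzcl).map (pullback.fst f yb).continuous
    rw [hfst_ξt] at this
    rw [hs']
    exact this
  have hinj : ∀ z ∈ ({z₁, z₂, z₃} : Set ↥(pullback f yb)), ∀ z' ∈ ({z₁, z₂, z₃} : Set ↥(pullback f yb)),
      ∀ l : Fin n, pullback.fst f yb z = σ l s → pullback.fst f yb z' = σ l s → z = z' := by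
    intro z _ z' _ l hz hz'
    exact subsingleton_preimage_fst_range_section f yb (σ l) (h.comp_eq_id l) ⟨s, hz.symm⟩
      ⟨s, hz'.symm⟩
  obtain ⟨l₁, hl₁, P₁⟩ := hlab z₁ (by simp)
  obtain ⟨l₂, hl₂, P₂⟩ := hlab z₂ (by simp)
  obtain ⟨l₃, hl₃, P₃⟩ := hlab z₃ (by simp)
  refine ⟨l₁, l₂, l₃, ?_, ?_, ?_, ?_, ?_, ?_, P₁, P₂, P₃⟩
  · rintro rfl; exact h12 (hinj z₁ (by simp) z₂ (by simp) l₁ hl₁ hl₂)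
  · rintro rfl; exact h13 (hinj z₁ (by simp) z₃ (by simp) l₁ hl₁ hl₃)
  · rintro rfl; exact h23 (hinj z₂ (by simp) z₃ (by simp) l₂ hl₂ hl₃)
  · intro e1; exact h12 (hinj z₁ (by simp) z₂ (by simp) l₁ hl₁ (hl₂.trans e1.symm))
  · intro e1; exact h13 (hinj z₁ (by simp) z₃ (by simp) l₁ hl₁ (hl₃.trans e1.symm))
  · intro e1; exact h23 (hinj z₂ (by simp) z₃ (by simp) l₂ hl₂ (hl₃.trans e1.symm))

/-- The labelled points `τᵢ(s)`, `τⱼ(s)` are distinct for `i ≠ j` (the sections are disjoint).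
[cite: DeJong1996, 4.20, p. 74] -/
theorem apply_τ_ne (h : ThreePointSituation f σ p τ U β) {i j : Fin n} (hij : i ≠ j) (s : S) :
    τ i s ≠ τ j s := fun e =>
  Set.disjoint_iff.mp (h.isPointedSemiStableCurve.pairwise_disjoint hij) ⟨⟨s, rfl⟩, ⟨s, e.symm⟩⟩

/-- **de Jong 1996, 4.21 with Lemma 4.20: the fibre of `pr₁ : T → 𝒞` over a point `c = pr₁ t₀`,
`t₀` closed in its fibre of `T → S`, is finite.** See the module docstring for the argument.
[cite: DeJong1996, Lemma 4.20 and 4.21, pp. 73–74] -/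
theorem finite_preimage_graphClosureFst_of_closed [IsNoetherian S]
    (h : ThreePointSituation f σ p τ U β) (hS : ∀ s : S, IsIntegrallyClosed (S.presheaf.stalk s))
    (hX : Flat f) (hT : Flat (graphClosureMap f p U β h.comm)) {t₀ : ↥(graphClosure f p U β h.comm)}
    (ht₀ : ∀ e, graphClosureMap f p U β h.comm e = graphClosureMap f p U β h.comm t₀ → t₀ ⤳ e →
      e = t₀) :
    (graphClosureFst f p U β h.comm ⁻¹' {graphClosureFst f p U β h.comm t₀}).Finite := by
  haveI := h.isProper
  haveI := h.isProper_model
  haveI := h.isPointedSemiStableCurve.isSemiStableCurve.locallyOfFinitePresentation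
  have hsst := h.isPointedSemiStableCurve.isSemiStableCurve
  set c := graphClosureFst f p U β h.comm t₀ with hcdef
  -- `c` is closed in its fibre `𝒞_s`
  have hc : ∀ e : C, p e = p c → c ⤳ e → e = c :=
    forall_eq_apply_of_isClosedMap (graphClosureFst f p U β h.comm) p
      (graphClosureFst f p U β h.comm).isClosedMap ht₀
  by_contra hinf
  -- a point `ζ` over `c` with `ξ = pr₂ ζ` a maximal point of `X_s`
  obtain ⟨ζ, hζc, hξmax⟩ := h.exists_maximal_snd_of_infinite hc hinf
  have hξs : f (graphClosureSnd f p U β h.comm ζ) = p c := by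
    rw [← h.apply_graphClosureFst_eq, hζc]
  -- three labels
  obtain ⟨l₁, l₂, l₃, h12, h13, h23, hx12, hx13, hx23, ⟨hsp₁, hsm₁⟩, ⟨hsp₂, hsm₂⟩, ⟨hsp₃, hsm₃⟩⟩ :=
    h.exists_three_labels hξs hξmax
  -- the points `t'_•` over `(c, σ_•(s))`
  have hpt : ∀ l : Fin n, graphClosureSnd f p U β h.comm ζ ⤳ σ l (p c) →
      ∃ t' : ↥(graphClosure f p U β h.comm), graphClosureFst f p U β h.comm t' = c ∧
        graphClosureSnd f p U β h.comm t' = σ l (p c) := by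
    intro l hl
    have hmem : σ l (p c) ∈ graphClosureSnd f p U β h.comm '' closure {ζ} := by
      rw [image_closure_singleton_of_isClosedMap (graphClosureSnd f p U β h.comm).continuous
        (graphClosureSnd f p U β h.comm).isClosedMap]
      exact specializes_iff_mem_closure.mp hl
    obtain ⟨t', ht', ht'x⟩ := hmem
    refine ⟨t', ?_, ht'x⟩
    have h1 : c ⤳ graphClosureFst f p U β h.comm t' :=
      hζc ▸ (specializes_iff_mem_closure.mpr ht').map (graphClosureFst f p U β h.comm).continuous
    have h2 : p (graphClosureFst f p U β h.comm t') = p c := by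
      rw [h.apply_graphClosureFst_eq, ht'x, ← Scheme.Hom.comp_apply, h.comp_eq_id]; rfl
    exact hc _ h2 h1
  -- the dichotomy for a label: `c` is the labelled point, or there is a vertical curve
  have hdich : ∀ l : Fin n, graphClosureSnd f p U β h.comm ζ ⤳ σ l (p c) →
      σ l (p c) ∈ f.smoothLocus →
      c = τ l (p c) ∨ ∃ d : C, d ⤳ c ∧ d ≠ c ∧ p d = p c ∧ (∀ e : C, p e = p c → e ⤳ d → e = d) ∧
        ∃ g : ↥(graphClosure f p U β h.comm), graphClosureFst f p U β h.comm g = d ∧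
          graphClosureSnd f p U β h.comm g = σ l (p c) := by
    intro l hl hsm
    obtain ⟨Γ, hΓ1, hΓ2⟩ := h.exists_section_graphClosure l
    obtain ⟨t', ht'c, ht'x⟩ := hpt l hl
    by_cases hq : (graphClosureSnd f p U β h.comm).QuasiFiniteAt t'
    · left
      have e1 := h.eq_section_apply_of_quasiFiniteAt hS hΓ2 hsm ht'x hq
      have e2 : graphClosureFst f p U β h.comm t' = τ l (p c) := by
        rw [e1, ← Scheme.Hom.comp_apply, hΓ1]
      exact ht'c.symm.trans e2
    · right
      obtain ⟨g, -, hgx, hdc, hdne, hpd, hmax⟩ := h.exists_maximal_fst_of_not_quasiFiniteAt hc ht'c hq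
      exact ⟨_, hdc, hdne, hpd, hmax, g, rfl, hgx.trans ht'x⟩
  -- two labels cannot both be the labelled point `c`
  have hLL : ∀ {l l' : Fin n}, l ≠ l' → c = τ l (p c) → c = τ l' (p c) → False :=
    fun hll' e1 e2 => h.apply_τ_ne hll' (p c) (e1.symm.trans e2)
  -- distinct labels give distinct vertical curves
  have hRR : ∀ {l l' : Fin n} {d : C}, σ l (p c) ≠ σ l' (p c) → d ⤳ c → d ≠ c → p d = p c →
      (∀ e : C, p e = p c → e ⤳ d → e = d) →
      (∃ g : ↥(graphClosure f p U β h.comm), graphClosureFst f p U β h.comm g = d ∧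
        graphClosureSnd f p U β h.comm g = σ l (p c)) →
      (∃ g : ↥(graphClosure f p U β h.comm), graphClosureFst f p U β h.comm g = d ∧
        graphClosureSnd f p U β h.comm g = σ l' (p c)) → False := by
    rintro l l' d hx hdc hdne hpd hmax ⟨g, hg1, hg2⟩ ⟨g', hg'1, hg'2⟩
    have hsub := h.subsingleton_preimage_graphClosureFst hS hX hT hdc hdne hpd.symm
      (fun e he => hmax e (he.trans hpd))
    have : g = g' := hsub hg1 hg'1
    rw [this, hg'2] at hg2
    exact hx hg2.symm
  -- the smooth labelled point `c = τ_l(s)` lies on at most one vertical curve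
  have hLR : ∀ {l : Fin n} {d d' : C}, c = τ l (p c) → d ⤳ c → p d = p c →
      (∀ e : C, p e = p c → e ⤳ d → e = d) → d' ⤳ c → p d' = p c →
      (∀ e : C, p e = p c → e ⤳ d' → e = d') → d = d' := by
    intro l d d' hcl hdc hpd hmax hd'c hpd' hmax'
    have hcsm : c ∈ p.smoothLocus := by rw [hcl]; exact h.apply_section_mem_smoothLocus l (p c)
    exact eq_of_maximal_specializes_of_mem_smoothLocus p hcsm hpd hpd' hmax hmax' hdc hd'c
  rcases hdich l₁ hsp₁ hsm₁ with e₁ | ⟨d₁, hd₁c, hd₁ne, hpd₁, hmax₁, hg₁⟩ <;>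
    rcases hdich l₂ hsp₂ hsm₂ with e₂ | ⟨d₂, hd₂c, hd₂ne, hpd₂, hmax₂, hg₂⟩ <;>
    rcases hdich l₃ hsp₃ hsm₃ with e₃ | ⟨d₃, hd₃c, hd₃ne, hpd₃, hmax₃, hg₃⟩
  · exact hLL h12 e₁ e₂
  · exact hLL h12 e₁ e₂
  · exact hLL h13 e₁ e₃
  · -- `c = τ_{l₁}(s)` smooth; `d₂ ≠ d₃` both through `c`
    have hne : d₂ ≠ d₃ := by
      rintro rfl; exact hRR hx23 hd₂c hd₂ne hpd₂ hmax₂ hg₂ hg₃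
    exact hne (hLR e₁ hd₂c hpd₂ hmax₂ hd₃c hpd₃ hmax₃)
  · exact hLL h23 e₂ e₃
  · have hne : d₁ ≠ d₃ := by
      rintro rfl; exact hRR hx13 hd₁c hd₁ne hpd₁ hmax₁ hg₁ hg₃
    exact hne (hLR e₂ hd₁c hpd₁ hmax₁ hd₃c hpd₃ hmax₃)
  · have hne : d₁ ≠ d₂ := by
      rintro rfl; exact hRR hx12 hd₁c hd₁ne hpd₁ hmax₁ hg₁ hg₂
    exact hne (hLR e₃ hd₁c hpd₁ hmax₁ hd₂c hpd₂ hmax₂)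
  · -- Case 1: three components of `𝒞_s` through `c`
    have h12' : d₁ ≠ d₂ := by rintro rfl; exact hRR hx12 hd₁c hd₁ne hpd₁ hmax₁ hg₁ hg₂
    have h13' : d₁ ≠ d₃ := by rintro rfl; exact hRR hx13 hd₁c hd₁ne hpd₁ hmax₁ hg₁ hg₃
    have h23' : d₂ ≠ d₃ := by rintro rfl; exact hRR hx23 hd₂c hd₂ne hpd₂ hmax₂ hg₂ hg₃
    rcases hsst.not_three_maximal_specializes hc hpd₁ hpd₂ hpd₃ hmax₁ hmax₂ hmax₃ hd₁c hd₂c hd₃c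
      with e | e | e
    · exact h12' e
    · exact h13' e
    · exact h23' e

/-- **de Jong 1996, 4.21: "the lemma implies that the morphism `pr₁ : T → 𝒞` has finite
fibres."** Every point of `T` specializes, inside its fibre of `T → S`, to a point closed in that
fibre; there the fibre of `pr₁` is finite (`finite_preimage_graphClosureFst_of_closed`), hence
discrete, so `pr₁` is quasi-finite at that point; the quasi-finite locus being open, `pr₁` is
quasi-finite everywhere, and its fibres are finite. [cite: DeJong1996, 4.21, p. 74] -/
theorem finite_preimage_graphClosureFst [IsNoetherian S] (h : ThreePointSituation f σ p τ U β)
    (hS : ∀ s : S, IsIntegrallyClosed (S.presheaf.stalk s)) (hX : Flat f)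
    (hT : Flat (graphClosureMap f p U β h.comm)) (c : C) :
    (graphClosureFst f p U β h.comm ⁻¹' {c}).Finite := by
  haveI := h.isProper
  haveI := h.isProper_model
  set pr₁ := graphClosureFst f p U β h.comm with hpr₁
  set π := graphClosureMap f p U β h.comm with hπ
  suffices hq : ∀ t : ↥(graphClosure f p U β h.comm), pr₁.QuasiFiniteAt t by
    haveI : LocallyQuasiFinite pr₁ := by
      rw [← Scheme.Hom.quasiFiniteLocus_eq_top_iff]
      exact top_le_iff.mp fun t _ => hq t
    exact pr₁.finite_preimage_singleton c
  intro t
  by_contra hqt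
  -- a point of the fibre of `T → S` through `t`, closed in it, where `pr₁` is not quasi-finite
  let Z : Set ↥(π.fiber (π t)) := π.fiberι (π t) ⁻¹' ((pr₁.quasiFiniteLocus : Set ↥(graphClosure f p U β h.comm))ᶜ)
  have hZ : IsClosed Z :=
    (pr₁.quasiFiniteLocus.isOpen.isClosed_compl).preimage (π.fiberι (π t)).continuous
  obtain ⟨z, hz, hzcl⟩ := hZ.exists_closed_singleton ⟨π.asFiber t, by
    show π.fiberι (π t) (π.asFiber t) ∉ (pr₁.quasiFiniteLocus : Set ↥(graphClosure f p U β h.comm))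
    rw [Scheme.Hom.fiberι_asFiber]
    exact hqt⟩
  apply hz
  show pr₁.QuasiFiniteAt (π.fiberι (π t) z)
  have hfin := h.finite_preimage_graphClosureFst_of_closed hS hX hT
    (forall_eq_of_isClosed_singleton_fiber π hzcl)
  have : Finite (pr₁.fiber (pr₁ (π.fiberι (π t) z))) :=
    (pr₁.fiberHomeo (pr₁ (π.fiberι (π t) z))).finite_iff.mpr hfin
  exact Scheme.Hom.quasiFiniteAt_iff_isOpen_singleton_asFiber.mpr (isOpen_discrete _)

end DeJong1996.ThreePointSituation

/-! ## The discharge -/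

/-- **PROOF of the named fact `DeJong1996GraphClosureFiniteFibres`** (de Jong 1996, Lemma 4.20
in the form 4.21 draws from it: in Situation 4.18 a)–c), e), g) over an integral Noetherian normal
base, with `X` and `T` flat over `S`, every fibre of `pr₁ : T → 𝒞` is finite).
[cite: DeJong1996, Lemma 4.20 and 4.21, pp. 73–74] -/
theorem DeJong1996GraphClosureFiniteFibres_holds : DeJong1996GraphClosureFiniteFibres.{u} := by
  intro X S C _ _ f _ n σ p τ U β h hS hX hT c
  exact h.finite_preimage_graphClosureFst hS hX hT c

/-! ## 4.21 unconditionally -/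

namespace DeJong1996.ThreePointSituation

variable {X S C : Scheme.{u}} [IsIntegral S] {f : X ⟶ S} [LocallyOfFinitePresentation f] {n : ℕ}
  {σ : Fin n → (S ⟶ X)} {p : C ⟶ S} {τ : Fin n → (S ⟶ C)} {U : S.Opens}
  {β : ((p ⁻¹ᵁ U : C.Opens) : Scheme.{u}) ⟶ (f ⁻¹ᵁ U : X.Opens)}

/-- **de Jong 1996, 4.21, unconditionally: in Situation 4.18 a)–c), e), g) with h), i) over a
Noetherian base, `pr₁ : T → 𝒞` is an isomorphism** (`isIso_graphClosureFst` fed with the two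
discharged facts `DeJong1996GraphClosureFiniteFibres_holds` and
`DeJong1996SemiStableCurveNormal_holds`). [cite: DeJong1996, 4.21, p. 74] -/
theorem isIso_graphClosureFst' [IsNoetherian S] (h : ThreePointSituation f σ p τ U β)
    (hS : ∀ s : S, IsIntegrallyClosed (S.presheaf.stalk s)) (hX : Flat f)
    (hT : Flat (graphClosureMap f p U β h.comm)) : IsIso (graphClosureFst f p U β h.comm) :=
  h.isIso_graphClosureFst DeJong1996GraphClosureFiniteFibres_holds
    DeJong1996SemiStableCurveNormal_holds hS hX hT

/-- **de Jong 1996, 4.21, conclusion, unconditionally: "the rational map `β` extends to a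
birational morphism `β : 𝒞 → X`"** — an `S`-morphism restricting to `β` on `𝒞_U`, an
isomorphism over `U`, mapping `τᵢ` to `σᵢ`. [cite: DeJong1996, 4.21–4.22, p. 74] -/
theorem exists_extension' [IsNoetherian S] (h : ThreePointSituation f σ p τ U β)
    (hS : ∀ s : S, IsIntegrallyClosed (S.presheaf.stalk s)) (hX : Flat f)
    (hT : Flat (graphClosureMap f p U β h.comm)) :
    ∃ β' : C ⟶ X, β' ≫ f = p ∧ (p ⁻¹ᵁ U).ι ≫ β' = β ≫ (f ⁻¹ᵁ U).ι ∧ IsIso (β' ∣_ f ⁻¹ᵁ U) ∧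
      ∀ i, τ i ≫ β' = σ i :=
  h.exists_extension DeJong1996GraphClosureFiniteFibres_holds DeJong1996SemiStableCurveNormal_holds
    hS hX hT

end DeJong1996.ThreePointSituation

end Literature.AlgebraicGeometry.Resolution

end
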